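import Literature.Analysis.FunctionSpaces.PVTrueUniversal
import Literature.Analysis.FunctionSpaces.PVTables
import Literature.Computability.MetaComplexity.BoundedArithUnivEngine
import HarnessLib

/-!
# Models of the true universal theory of `(ℕ, PV)`: facts, sharply bounded search, collection

Continuation of `PVTrueUniversal.lean` (support for Buss's witnessing theorem in `PV` form,
Krajíček 1995, Thm. 7.6.3; Avigad 2002, §3–4).  In a model `K ⊨ trueUnivPV` we transfer from `ℕ`
the specifications of the symbols of `PVPrograms.lean` / `PVTables.lean` that the strict-form
and `PIND` arguments use, and derive the two model-theoretic tools: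

* `substCtx`, `instCtx₁`, `instCtx₂` — substitution of terms for context variables, and
  instantiation of context variables at parameters (plumbing between the "context variables"
  format of formulas and the "parameters" format of Herbrand saturation), stated once for an
  *arbitrary* language `L` (the `Language.qsym k` copies `QSym.substCtx`, `QSym.instCtx` of
  `BoundedArithUnivStrict/Engine.lean` are instances and can be retired onto these), with
  `exists_skolem_sym_ctx₁/₂` (Skolem symbols for `∀ j ∃ y Θ(p̄, j, y)` and `∀ x w ∃ y Θ(p̄, x, w, y)`
  in `L(PV)`); `substCtx` is consumed by the strict-form and `PIND` files;
* facts: `pair_decode` (pairing by `y + w · (1 # t)`), `lsearch_le'`, `ne_zero_of_lt_lsearch'`,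
  `eq_zero_of_lsearch_le'` and **`forall_le_len_iff`** (a sharply bounded universal quantifier
  over a `0/1`-valued symbol is an open condition), `entry_tbl'`, `tbl_le'` (tables);
* **collection** (`exists_table`): in a Herbrand-saturated `K`, if
  `∀ i ≤ |s| ∃ w ≤ r(i) ρ(x̄, i, w)` with `ρ` open then one `W` below a term bound has digits
  `entry (W, i, 2b+1) ≤ r(i)` satisfying `ρ` for all `i ≤ |s|` — sharply bounded replacement
  (`BB Σᵇ₁`, Buss 1986, §2.7) obtained from Herbrand's theorem and the table symbol, as in
  Krajíček 1995, proof of Thm. 7.6.3.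

## References

* J. Krajíček, *Bounded Arithmetic, Propositional Logic and Complexity Theory*, CUP 1995, §7.6.
* J. Avigad, *Saturated models of universal theories*, APAL 118 (2002), Thm. 3.3.
* S. R. Buss, *Bounded Arithmetic*, Bibliopolis 1986, §2.5, §2.7.
-/

namespace Literature.Analysis.FunctionSpaces

open FirstOrder FirstOrder.Language FirstOrder.Language.BoundedFormula
open Literature.Computability.MetaComplexity Literature.Computability.MetaComplexity.BASICModel
open Literature.ModelTheory.UniversalTheories

/-! ## Term helpers -/

section Terms

variable {α : Type}

/-- A unary symbol applied to a term. [folklore] -/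
abbrev fn1 (f : PVFun 1) (t : Language.pv.Term α) : Language.pv.Term α := Term.func f ![t]

/-- A binary symbol applied to terms. [folklore] -/
abbrev fn2 (f : PVFun 2) (t u : Language.pv.Term α) : Language.pv.Term α := Term.func f ![t, u]

/-- A ternary symbol applied to terms. [folklore] -/
abbrev fn3 (f : PVFun 3) (t u w : Language.pv.Term α) : Language.pv.Term α := Term.func f ![t, u, w]

variable {P : Type} [Language.pv.Structure P] (v : α → P)

/-- Realizing `fn1`. [folklore] -/
@[simp] theorem realize_fn1 (f : PVFun 1) (t : Language.pv.Term α) :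
    (fn1 f t).realize v = papp f ![t.realize v] := by
  rw [Term.realize]; congr 1; funext i; fin_cases i; rfl

/-- Realizing `fn2`. [folklore] -/
@[simp] theorem realize_fn2 (f : PVFun 2) (t u : Language.pv.Term α) :
    (fn2 f t u).realize v = papp f ![t.realize v, u.realize v] := by
  rw [Term.realize]; congr 1; funext i; fin_cases i <;> rfl

/-- Realizing `fn3`. [folklore] -/
@[simp] theorem realize_fn3 (f : PVFun 3) (t u w : Language.pv.Term α) :
    (fn3 f t u w).realize v = papp f ![t.realize v, u.realize v, w.realize v] := by
  rw [Term.realize]; congr 1; funext i; fin_cases i <;> rfl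

/-- A symbol applied to a realized `1`-vector of terms (the shape left by unfolding
`Term.realize`). [folklore] -/
@[simp] theorem funMap_vec1 (f : PVFun 1) (t : Language.pv.Term α) :
    (Structure.funMap (L := Language.pv) f fun i => Term.realize v ((![t] : Fin 1 → _) i)) =
      papp f ![t.realize v] := by
  congr 1; funext i; fin_cases i; rfl

/-- A symbol applied to a realized `2`-vector of terms. [folklore] -/
@[simp] theorem funMap_vec2 (f : PVFun 2) (t u : Language.pv.Term α) :
    (Structure.funMap (L := Language.pv) f fun i => Term.realize v ((![t, u] : Fin 2 → _) i)) =
      papp f ![t.realize v, u.realize v] := by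
  congr 1; funext i; fin_cases i <;> rfl

/-- A symbol applied to a realized `3`-vector of terms. [folklore] -/
@[simp] theorem funMap_vec3 (f : PVFun 3) (t u w : Language.pv.Term α) :
    (Structure.funMap (L := Language.pv) f fun i => Term.realize v ((![t, u, w] : Fin 3 → _) i)) =
      papp f ![t.realize v, u.realize v, w.realize v] := by
  congr 1; funext i; fin_cases i <;> rfl

end Terms

/-! ## Substituting terms for context variables (any language) -/

section SubstCtx

variable {L : Language} {n m : ℕ}

/-- **Substituting terms for the context variables** of a formula in context variables:
`substCtx π σ` is `π(σ₀, …, σ_{n-1})`, a formula in the context of the `σᵢ` (any language; the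
`Language.qsym k` instance is `QSym.substCtx`). [folklore] -/
def substCtx (π : L.BoundedFormula Empty n) (σ : Fin n → L.Term (Empty ⊕ Fin m)) : L.BoundedFormula Empty m :=
  BoundedFormula.relabel (id : Empty ⊕ Fin m → Empty ⊕ Fin m)
    ((π.toFormula).subst (Sum.elim (fun e => e.elim) σ))

/-- `substCtx` preserves openness. [folklore] -/
theorem isQF_substCtx {π : L.BoundedFormula Empty n} (hπ : π.IsQF) (σ : Fin n → L.Term (Empty ⊕ Fin m)) :
    (substCtx π σ).IsQF :=
  (hπ.toFormula.subst _).relabel _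

/-- Semantics of `substCtx`. [folklore] -/
theorem realize_substCtx {P : Type*} [L.Structure P] (π : L.BoundedFormula Empty n)
    (σ : Fin n → L.Term (Empty ⊕ Fin m)) (ys : Fin m → P) :
    (substCtx π σ).Realize default ys ↔ π.Realize default fun i => (σ i).realize (Sum.elim default ys) := by
  rw [substCtx, realize_relabel]
  have e0 : (ys ∘ Fin.natAdd m : Fin 0 → P) = default := Subsingleton.elim _ _
  have e1 : (ys ∘ Fin.castAdd 0) = ys := by funext i; simp
  rw [e0, e1, Function.comp_id]
  refine (realize_subst (φ := π.toFormula) (v := Sum.elim default ys) (xs := default)).trans ?_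
  refine (realize_toFormula π _).trans ?_
  have e2 : ((fun a => Term.realize (Sum.elim (default : Empty → P) ys)
      (Sum.elim (fun e => e.elim) σ a)) ∘ Sum.inl) = (default : Empty → P) := Subsingleton.elim _ _
  rw [e2]
  rfl

end SubstCtx

/-! ## Instantiating context variables at parameters (any language) -/

section InstCtx

variable {L : Language} {K : Type*} {a : ℕ}

/-- The variable map of `instCtx₁`: parameters, then one free variable `j`, then the bound
variable `y`. [folklore] -/
def instCtx₁Map (pa : Fin a → K) : Fin (a + 2) → (K ⊕ Fin 1) ⊕ Fin 1 :=
  Fin.snoc (Fin.snoc (fun i => Sum.inl (Sum.inl (pa i))) (Sum.inl (Sum.inr 0))) (Sum.inr 0)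

/-- **Instantiation** of `Θ(p̄, j, y)` (context variables) at parameters `p̄`: free variable
`j`, bound variable `y` (any language). [folklore] -/
def instCtx₁ (Θ : L.BoundedFormula Empty (a + 2)) (pa : Fin a → K) : L.BoundedFormula (K ⊕ Fin 1) 1 :=
  BoundedFormula.relabel (Sum.elim Empty.elim (instCtx₁Map pa)) Θ.toFormula

/-- `instCtx₁` preserves openness. [folklore] -/
theorem isQF_instCtx₁ {Θ : L.BoundedFormula Empty (a + 2)} (hΘ : Θ.IsQF) (pa : Fin a → K) :
    (instCtx₁ Θ pa).IsQF :=
  hΘ.toFormula.relabel _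

/-- Semantics of `instCtx₁`. [folklore] -/
theorem realize_instCtx₁ [L.Structure K] (Θ : L.BoundedFormula Empty (a + 2)) (pa : Fin a → K) (j y : K) :
    (instCtx₁ Θ pa).Realize (Sum.elim id ![j]) ![y] ↔ Θ.Realize default (Fin.snoc (Fin.snoc pa j) y) := by
  rw [instCtx₁, realize_relabel]
  have e3 : (![y] ∘ Fin.natAdd 1 : Fin 0 → K) = default := Subsingleton.elim _ _
  rw [e3]
  refine (realize_toFormula Θ _).trans ?_
  have e1 : ((Sum.elim (Sum.elim id ![j]) (![y] ∘ Fin.castAdd 0) ∘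
      Sum.elim Empty.elim (instCtx₁Map pa)) ∘ Sum.inl : Empty → K) = default :=
    Subsingleton.elim _ _
  have e2 : ((Sum.elim (Sum.elim id ![j]) (![y] ∘ Fin.castAdd 0) ∘
      Sum.elim Empty.elim (instCtx₁Map pa)) ∘ Sum.inr) = Fin.snoc (Fin.snoc pa j) y := by
    funext i
    simp only [Function.comp_apply, Sum.elim_inr, instCtx₁Map]
    cases i using Fin.lastCases with
    | last => simp
    | cast i =>
      cases i using Fin.lastCases with
      | last => simp
      | cast i => simp
  rw [e1, e2]

/-- The variable map of `instCtx₂`: parameters, two free variables `x, w`, the bound variable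
`y`. [folklore] -/
def instCtx₂Map (pa : Fin a → K) : Fin (a + 3) → (K ⊕ Fin 2) ⊕ Fin 1 :=
  Fin.snoc (Fin.snoc (Fin.snoc (fun i => Sum.inl (Sum.inl (pa i))) (Sum.inl (Sum.inr 0)))
    (Sum.inl (Sum.inr 1))) (Sum.inr 0)

/-- **Instantiation** of `Θ(p̄, x, w, y)` at parameters `p̄`: free variables `x, w`, bound
variable `y` (any language; the `Language.qsym k` instance is `QSym.instCtx`). [folklore] -/
def instCtx₂ (Θ : L.BoundedFormula Empty (a + 3)) (pa : Fin a → K) : L.BoundedFormula (K ⊕ Fin 2) 1 :=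
  BoundedFormula.relabel (Sum.elim Empty.elim (instCtx₂Map pa)) Θ.toFormula

/-- `instCtx₂` preserves openness. [folklore] -/
theorem isQF_instCtx₂ {Θ : L.BoundedFormula Empty (a + 3)} (hΘ : Θ.IsQF) (pa : Fin a → K) :
    (instCtx₂ Θ pa).IsQF :=
  hΘ.toFormula.relabel _

/-- Semantics of `instCtx₂`. [folklore] -/
theorem realize_instCtx₂ [L.Structure K] (Θ : L.BoundedFormula Empty (a + 3)) (pa : Fin a → K) (x w y : K) :
    (instCtx₂ Θ pa).Realize (Sum.elim id ![x, w]) ![y] ↔ Θ.Realize default (Fin.snoc (Fin.snoc (Fin.snoc pa x) w) y) := by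
  rw [instCtx₂, realize_relabel]
  have e3 : (![y] ∘ Fin.natAdd 1 : Fin 0 → K) = default := Subsingleton.elim _ _
  rw [e3]
  refine (realize_toFormula Θ _).trans ?_
  have e1 : ((Sum.elim (Sum.elim id ![x, w]) (![y] ∘ Fin.castAdd 0) ∘
      Sum.elim Empty.elim (instCtx₂Map pa)) ∘ Sum.inl : Empty → K) = default :=
    Subsingleton.elim _ _
  have e2 : ((Sum.elim (Sum.elim id ![x, w]) (![y] ∘ Fin.castAdd 0) ∘
      Sum.elim Empty.elim (instCtx₂Map pa)) ∘ Sum.inr) = Fin.snoc (Fin.snoc (Fin.snoc pa x) w) y := by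
    funext i
    simp only [Function.comp_apply, Sum.elim_inr, instCtx₂Map]
    cases i using Fin.lastCases with
    | last => simp
    | cast i =>
      cases i using Fin.lastCases with
      | last => simp
      | cast i =>
        cases i using Fin.lastCases with
        | last => simp
        | cast i => simp
  rw [e1, e2]

end InstCtx

/-! ## Skolem symbols in context (`L(PV)`) -/

section Skolem

variable {K : Type} [Language.boundedArith.Structure K] [Language.pv.Structure K]
  [boundedArithToPV.IsExpansionOn K] [hKB : K ⊨ BASIC] {a : ℕ}

/-- **Skolem symbols for `∀ j ∃ y Θ(p̄, j, y)`** in a Herbrand-saturated model of `trueUnivPV`.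
[cite: Avigad2002, Theorem 3.3] -/
theorem exists_skolem_sym_ctx₁ (hK : K ⊨ trueUnivPV) (hsat : IsHerbrandSaturated Language.pv K)
    {Θ : Language.pv.BoundedFormula Empty (a + 2)} (hΘ : Θ.IsQF) (pa : Fin a → K)
    (h : ∀ j : K, ∃ y : K, Θ.Realize default (Fin.snoc (Fin.snoc pa j) y)) :
    ∃ (q : ℕ) (c : Fin q → K) (G : PVFun (q + 1)),
      ∀ j : K, Θ.Realize default (Fin.snoc (Fin.snoc pa j) (papp G (Fin.snoc c j))) := by
  obtain ⟨q, c, G, hG⟩ := exists_skolem_sym hK hsat (isQF_instCtx₁ hΘ pa) fun xs => by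
    obtain ⟨y, hy⟩ := h (xs 0)
    refine ⟨y, ?_⟩
    have e : xs = ![xs 0] := by funext i; fin_cases i; rfl
    rw [e, realize_instCtx₁]
    exact hy
  refine ⟨q, c, G, fun j => ?_⟩
  have := hG ![j]
  rw [realize_instCtx₁, Fin.append_right_eq_snoc c ![j] ] at this
  simpa using this

/-- **Skolem symbols for `∀ x w ∃ y Θ(p̄, x, w, y)`** in a Herbrand-saturated model of
`trueUnivPV`. [cite: Avigad2002, Theorem 3.3] -/
theorem exists_skolem_sym_ctx₂ (hK : K ⊨ trueUnivPV) (hsat : IsHerbrandSaturated Language.pv K)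
    {Θ : Language.pv.BoundedFormula Empty (a + 3)} (hΘ : Θ.IsQF) (pa : Fin a → K)
    (h : ∀ x w : K, ∃ y : K, Θ.Realize default (Fin.snoc (Fin.snoc (Fin.snoc pa x) w) y)) :
    ∃ (q : ℕ) (c : Fin q → K) (G : PVFun (q + 2)),
      ∀ x w : K, Θ.Realize default
        (Fin.snoc (Fin.snoc (Fin.snoc pa x) w) (papp G (Fin.snoc (Fin.snoc c x) w))) := by
  obtain ⟨q, c, G, hG⟩ := exists_skolem_sym hK hsat (isQF_instCtx₂ hΘ pa) fun xs => by
    obtain ⟨y, hy⟩ := h (xs 0) (xs 1)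
    refine ⟨y, ?_⟩
    have e : xs = ![xs 0, xs 1] := by funext i; fin_cases i <;> rfl
    rw [e, realize_instCtx₂]
    exact hy
  refine ⟨q, c, G, fun x w => ?_⟩
  have := hG ![x, w]
  rw [realize_instCtx₂, QSym.append_two] at this
  simpa using this

end Skolem

/-! ## Facts transferred from `ℕ` -/

section Facts

variable {K : Type} [Language.boundedArith.Structure K] [Language.pv.Structure K]
  [boundedArithToPV.IsExpansionOn K] [hKB : K ⊨ BASIC]

omit [Language.pv.Structure K] [boundedArithToPV.IsExpansionOn K] in
/-- In `K`, the numeral `2` of Buss's language denotes `2`. [folklore] -/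
@[simp] theorem realize_natConst_two' {β : Type} (v : β → K) :
    (natConst 2 : Language.boundedArith.Term β).realize v = 2 := by
  rw [realize_natConst_two, mSucc_eq, mSucc_eq, mZero_eq, zero_add, one_add_one_eq_two]

omit [Language.boundedArith.Structure K] [Language.pv.Structure K] [boundedArithToPV.IsExpansionOn K]
  hKB in
/-- A tuple on `Fin (p + 1)` is `Fin.snoc` of its initial part and last entry. [folklore] -/
theorem exists_eq_snoc {P : Type} {p : ℕ} (xs : Fin (p + 1) → P) :
    ∃ (ys : Fin p → P) (u : P), xs = Fin.snoc ys u :=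
  ⟨Fin.init xs, xs (Fin.last p), (Fin.snoc_init_self xs).symm⟩

/-! ### Pairing -/

/-- **Fact (pairing).** For `y ≤ t`, the pair `p = y + w · (1 # t)` decodes as
`lspLen (p, t) = y`, `mspLen (p, t) = w`. [cite: Buss1986, §2.5] -/
theorem pair_decode (hK : K ⊨ trueUnivPV) {y t : K} (hy : y ≤ t) (w : K) :
    papp PVFun.lspLen ![y + w * mSmash 1 t, t] = y ∧ papp PVFun.mspLen ![y + w * mSmash 1 t, t] = w := by
  -- variables: 0 = y, 1 = w, 2 = t
  let pT : Language.pv.Term (Empty ⊕ Fin 3) :=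
    fn2 PVFun.add (cv 0) (fn2 PVFun.mul (cv 1) (fn2 PVFun.smash pone (cv 2)))
  let Ψ : Language.pv.BoundedFormula Empty 3 :=
    Term.le (cv 0) (cv 2) ⟹
      (Term.bdEqual (fn2 PVFun.lspLen pT (cv 2)) (cv 0) ⊓ Term.bdEqual (fn2 PVFun.mspLen pT (cv 2)) (cv 1))
  have hΨ : Ψ.IsUniversal :=
    ((IsAtomic.rel _ _).isQF.imp ((IsAtomic.equal _ _).isQF.inf (IsAtomic.equal _ _).isQF)).isUniversal
  have hfact := realize_of_nat hK hΨ (fun u => by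
    simp only [Ψ, pT, realize_imp, realize_inf, realize_bdEqual, Term.realize_le, realize_fn2,
      Term.realize_var, Sum.elim_inr, papp_nat, PVFun.eval_lspLen, PVFun.eval_mspLen, PVFun.eval_add,
      PVFun.eval_mul, PVFun.eval_smash, Matrix.cons_val_zero, Matrix.cons_val_one, pone, ιt,
      LHom.realize_onTerm, realize_natConst, Nat.size_one, one_mul]
    intro hle
    have hlt : u 0 < 2 ^ Nat.size (u 2) := lt_of_le_of_lt hle (Nat.lt_size_self _)
    constructor
    · rw [Nat.add_mul_mod_self_right, Nat.mod_eq_of_lt hlt]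
    · rw [Nat.add_mul_div_right _ _ (Nat.two_pow_pos _), Nat.div_eq_of_lt hlt, zero_add])
    ![y, w, t]
  simp only [Ψ, pT, realize_imp, realize_inf, realize_bdEqual, realize_pvle, realize_fn2,
    Term.realize_var, Sum.elim_inr, Matrix.cons_val_zero, Matrix.cons_val_one, Matrix.cons_val,
    realize_pone, papp_add, papp_mul, papp_smash, mAdd_eq, mMul_eq] at hfact
  exact hfact hy

/-! ### Sharply bounded search -/

variable {m : ℕ}

/-- **Fact (`lsearch`, bound).** `lsearch G (ȳ, u) ≤ |u| + 1` in `K`. [cite: Buss1986, Ch. 6] -/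
theorem lsearch_le' (hK : K ⊨ trueUnivPV) (G : PVFun (m + 1)) (ys : Fin m → K) (u : K) :
    papp (PVFun.lsearch G) (Fin.snoc ys u) ≤ mLen u + 1 := by
  let Ψ : Language.pv.BoundedFormula Empty (m + 1) :=
    Term.le (Term.func (PVFun.lsearch G) fun i => cv i)
      (fn1 PVFun.succ (fn1 PVFun.len (cv (Fin.last m))))
  have hΨ : Ψ.IsUniversal := (IsAtomic.rel _ _).isQF.isUniversal
  have hfact := realize_of_nat hK hΨ (fun xs => by
    obtain ⟨zs, v, rfl⟩ := exists_eq_snoc xs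
    simp only [Ψ, Term.realize_le, Term.realize, Sum.elim_inr, funMap_vec1, papp_nat, PVFun.eval_succ,
      PVFun.eval_len, Matrix.cons_val_zero, Fin.snoc_last]
    exact PVFun.lsearch_le G zs v) (Fin.snoc ys u)
  simp only [Ψ, realize_pvle, Term.realize, Sum.elim_inr, funMap_vec1, papp_succ, papp_len,
    mSucc_eq, Fin.snoc_last] at hfact
  exact hfact

/-- **Fact (`lsearch`, minimality).** Below `lsearch G (ȳ, u)`, `G(ȳ, ·) ≠ 0` in `K`.
[cite: Buss1986, Ch. 6] -/
theorem ne_zero_of_lt_lsearch' (hK : K ⊨ trueUnivPV) (G : PVFun (m + 1)) (ys : Fin m → K) (u : K)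
    {i : K} (hi : i < papp (PVFun.lsearch G) (Fin.snoc ys u)) : papp G (Fin.snoc ys i) ≠ 0 := by
  -- context: ȳ (m), u, i
  let lsT : Language.pv.Term (Empty ⊕ Fin (m + 2)) :=
    Term.func (PVFun.lsearch G) fun j : Fin (m + 1) => cv (Fin.castSucc j)
  let GT : Language.pv.Term (Empty ⊕ Fin (m + 2)) :=
    Term.func G (Fin.snoc (fun j : Fin m => cv (Fin.castSucc (Fin.castSucc j))) (cv (Fin.last (m + 1))))
  let Ψ : Language.pv.BoundedFormula Empty (m + 2) :=
    ∼(Term.le lsT (cv (Fin.last (m + 1)))) ⟹ ∼(Term.bdEqual GT (ιt 0))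
  have hΨ : Ψ.IsUniversal :=
    ((IsAtomic.rel _ _).isQF.not.imp (IsAtomic.equal _ _).isQF.not).isUniversal
  have hfact := realize_of_nat hK hΨ (fun xs => by
    obtain ⟨xs', j, rfl⟩ := exists_eq_snoc xs
    obtain ⟨zs, v, rfl⟩ := exists_eq_snoc xs'
    simp only [Ψ, lsT, GT, realize_imp, realize_not, realize_bdEqual, Term.realize_le, Term.realize,
      QSym.realize_snoc_terms, Sum.elim_inr, papp_nat, Fin.snoc_last, Fin.snoc_castSucc, ιt,
      LHom.realize_onTerm, Literature.Computability.MetaComplexity.realize_zero, not_le]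
    exact fun h => PVFun.ne_zero_of_lt_lsearch G zs v h) (Fin.snoc (Fin.snoc ys u) i)
  simp only [Ψ, lsT, GT, realize_imp, realize_not, realize_bdEqual, realize_pvle, Term.realize,
    QSym.realize_snoc_terms, Sum.elim_inr, Fin.snoc_last, Fin.snoc_castSucc, realize_ιt,
    realize_term_zero, mZero_eq, not_le] at hfact
  exact hfact hi

/-- **Fact (`lsearch`, finds a zero).** If `lsearch G (ȳ, u) ≤ |u|` then `G` vanishes there, in
`K`. [cite: Buss1986, Ch. 6] -/
theorem eq_zero_of_lsearch_le' (hK : K ⊨ trueUnivPV) (G : PVFun (m + 1)) (ys : Fin m → K) (u : K)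
    (h : papp (PVFun.lsearch G) (Fin.snoc ys u) ≤ mLen u) :
    papp G (Fin.snoc ys (papp (PVFun.lsearch G) (Fin.snoc ys u))) = 0 := by
  let lsT : Language.pv.Term (Empty ⊕ Fin (m + 1)) := Term.func (PVFun.lsearch G) fun i => cv i
  let GT : Language.pv.Term (Empty ⊕ Fin (m + 1)) :=
    Term.func G (Fin.snoc (fun j : Fin m => cv (Fin.castSucc j)) lsT)
  let Ψ : Language.pv.BoundedFormula Empty (m + 1) :=
    Term.le lsT (fn1 PVFun.len (cv (Fin.last m))) ⟹ Term.bdEqual GT (ιt 0)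
  have hΨ : Ψ.IsUniversal := ((IsAtomic.rel _ _).isQF.imp (IsAtomic.equal _ _).isQF).isUniversal
  have hfact := realize_of_nat hK hΨ (fun xs => by
    obtain ⟨zs, v, rfl⟩ := exists_eq_snoc xs
    simp only [Ψ, GT, lsT, realize_imp, realize_bdEqual, Term.realize_le, Term.realize,
      QSym.realize_snoc_terms, Sum.elim_inr, papp_nat, Fin.snoc_last, Fin.snoc_castSucc, funMap_vec1,
      PVFun.eval_len, Matrix.cons_val_zero, ιt, LHom.realize_onTerm,
      Literature.Computability.MetaComplexity.realize_zero]
    exact fun h => PVFun.eq_zero_of_lsearch_le G zs v h) (Fin.snoc ys u)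
  simp only [Ψ, GT, lsT, realize_imp, realize_bdEqual, realize_pvle, Term.realize, QSym.realize_snoc_terms,
    Sum.elim_inr, Fin.snoc_last, Fin.snoc_castSucc, funMap_vec1, papp_len, realize_ιt, realize_term_zero,
    mZero_eq] at hfact
  exact hfact h

/-- **A sharply bounded universal quantifier over a `0/1`-valued symbol is open** (in `K`):
`(∀ z ≤ |u|, G(ȳ, z) = 1) ↔ lsearch G (ȳ, u) = |u| + 1`. [cite: Buss1986, Ch. 6] -/
theorem forall_le_len_iff (hK : K ⊨ trueUnivPV) (G : PVFun (m + 1)) (ys : Fin m → K) (u : K)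
    (h01 : ∀ z, papp G (Fin.snoc ys z) = 0 ∨ papp G (Fin.snoc ys z) = 1) :
    (∀ z, z ≤ mLen u → papp G (Fin.snoc ys z) = 1) ↔
      papp (PVFun.lsearch G) (Fin.snoc ys u) = mLen u + 1 := by
  have h0ne : (0 : K) ≠ 1 := zero_ne_one
  constructor
  · intro hall
    have hle := lsearch_le' hK G ys u
    rcases hle.lt_or_eq with hlt | heq
    · have hle' : papp (PVFun.lsearch G) (Fin.snoc ys u) ≤ mLen u := (lt_add_one_iff' _ _).1 hlt
      have h0 := eq_zero_of_lsearch_le' hK G ys u hle'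
      have h1 := hall _ hle'
      rw [h0] at h1
      exact absurd h1 h0ne
    · exact heq
  · intro heq z hz
    have hlt : z < papp (PVFun.lsearch G) (Fin.snoc ys u) := by
      rw [heq]; exact (lt_add_one_iff' _ _).2 hz
    rcases h01 z with h0 | h1
    · exact absurd h0 (ne_zero_of_lt_lsearch' hK G ys u hlt)
    · exact h1

/-! ### Tables -/

variable {p : ℕ}

/-- **Fact (decoding a table).** For `i ≤ |u|` and `F(ȳ, i) ≤ B(ȳ)`:
`entry (tbl F B (ȳ, u), i, 2 B(ȳ) + 1) = F(ȳ, i)` in `K`. [cite: Buss1986, §2.5] -/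
theorem entry_tbl' (hK : K ⊨ trueUnivPV) (F : PVFun (p + 1)) (B : PVFun p) (ys : Fin p → K)
    {u i : K} (hi : i ≤ mLen u) (hF : papp F (Fin.snoc ys i) ≤ papp B ys) :
    papp PVFun.entry ![papp (PVFun.tbl F B) (Fin.snoc ys u), i, 2 * papp B ys + 1] =
      papp F (Fin.snoc ys i) := by
  -- context: ȳ (p), u, i
  let BT : Language.pv.Term (Empty ⊕ Fin (p + 2)) :=
    Term.func B fun j : Fin p => cv (Fin.castSucc (Fin.castSucc j))
  let FT : Language.pv.Term (Empty ⊕ Fin (p + 2)) :=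
    Term.func F (Fin.snoc (fun j : Fin p => cv (Fin.castSucc (Fin.castSucc j))) (cv (Fin.last (p + 1))))
  let tblT : Language.pv.Term (Empty ⊕ Fin (p + 2)) :=
    Term.func (PVFun.tbl F B) fun j : Fin (p + 1) => cv (Fin.castSucc j)
  let wT : Language.pv.Term (Empty ⊕ Fin (p + 2)) :=
    fn1 PVFun.succ (fn2 PVFun.mul (ιt (natConst 2)) BT)
  let Ψ : Language.pv.BoundedFormula Empty (p + 2) :=
    Term.le (cv (Fin.last (p + 1))) (fn1 PVFun.len (cv (Fin.castSucc (Fin.last p)))) ⟹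
      Term.le FT BT ⟹ Term.bdEqual (fn3 PVFun.entry tblT (cv (Fin.last (p + 1))) wT) FT
  have hΨ : Ψ.IsUniversal :=
    ((IsAtomic.rel _ _).isQF.imp ((IsAtomic.rel _ _).isQF.imp (IsAtomic.equal _ _).isQF)).isUniversal
  have hfact := realize_of_nat hK hΨ (fun xs => by
    obtain ⟨xs', j, rfl⟩ := exists_eq_snoc xs
    obtain ⟨zs, v, rfl⟩ := exists_eq_snoc xs'
    simp only [Ψ, BT, FT, tblT, wT, realize_imp, realize_bdEqual, Term.realize_le, Term.realize,
      QSym.realize_snoc_terms, Sum.elim_inr, papp_nat, Fin.snoc_last, Fin.snoc_castSucc, funMap_vec1,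
      funMap_vec2, funMap_vec3, PVFun.eval_len, PVFun.eval_succ, PVFun.eval_mul, Matrix.cons_val_zero,
      Matrix.cons_val_one, ιt, LHom.realize_onTerm, realize_natConst]
    intro hij hFB
    rw [PVFun.entry_tbl F B zs hij]
    exact min_eq_left hFB) (Fin.snoc (Fin.snoc ys u) i)
  simp only [Ψ, BT, FT, tblT, wT, realize_imp, realize_bdEqual, realize_pvle, Term.realize,
    QSym.realize_snoc_terms, Sum.elim_inr, Fin.snoc_last, Fin.snoc_castSucc, funMap_vec1, funMap_vec2,
    funMap_vec3, papp_len, papp_succ, papp_mul, mSucc_eq, mMul_eq, realize_ιt, realize_natConst_two'] at hfact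
  exact hfact hi hF

/-- **Fact (size of a table).** `tbl F B (ȳ, u) ≤ (2u+1) # (2 B(ȳ) + 1)` in `K`.
[cite: Buss1986, §2.5] -/
theorem tbl_le' (hK : K ⊨ trueUnivPV) (F : PVFun (p + 1)) (B : PVFun p) (ys : Fin p → K) (u : K) :
    papp (PVFun.tbl F B) (Fin.snoc ys u) ≤ mSmash (2 * u + 1) (2 * papp B ys + 1) := by
  let BT : Language.pv.Term (Empty ⊕ Fin (p + 1)) := Term.func B fun j : Fin p => cv (Fin.castSucc j)
  let tblT : Language.pv.Term (Empty ⊕ Fin (p + 1)) := Term.func (PVFun.tbl F B) fun j => cv j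
  let two : Language.pv.Term (Empty ⊕ Fin (p + 1)) := ιt (natConst 2)
  let bd : Language.pv.Term (Empty ⊕ Fin (p + 1)) :=
    fn2 PVFun.smash (fn1 PVFun.succ (fn2 PVFun.mul two (cv (Fin.last p))))
      (fn1 PVFun.succ (fn2 PVFun.mul two BT))
  let Ψ : Language.pv.BoundedFormula Empty (p + 1) := Term.le tblT bd
  have hΨ : Ψ.IsUniversal := (IsAtomic.rel _ _).isQF.isUniversal
  have hfact := realize_of_nat hK hΨ (fun xs => by
    obtain ⟨zs, v, rfl⟩ := exists_eq_snoc xs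
    simp only [Ψ, BT, tblT, two, bd, Term.realize_le, Term.realize, Sum.elim_inr, papp_nat,
      Fin.snoc_last, Fin.snoc_castSucc, funMap_vec1, funMap_vec2, PVFun.eval_succ, PVFun.eval_mul,
      PVFun.eval_smash, Matrix.cons_val_zero, Matrix.cons_val_one, ιt, LHom.realize_onTerm, realize_natConst]
    have h := PVFun.eval_tbl_lt F B zs v
    rw [PVFun.size_two_mul_add_one]
    exact h.le) (Fin.snoc ys u)
  simp only [Ψ, BT, tblT, two, bd, realize_pvle, Term.realize, Sum.elim_inr, Fin.snoc_last,
    Fin.snoc_castSucc, funMap_vec1, funMap_vec2, papp_succ, papp_mul, papp_smash, mSucc_eq,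
    mMul_eq, realize_ιt, realize_natConst_two'] at hfact
  exact hfact

end Facts

/-! ## Collection: a table of witnesses from Herbrand saturation -/

section Collect

variable {K : Type} [Language.boundedArith.Structure K] [Language.pv.Structure K]
  [boundedArithToPV.IsExpansionOn K] [hKB : K ⊨ BASIC] {n : ℕ}

/-- Dropping the second-to-last argument: `skipArg G (c̄, b, i) = G(c̄, i)`. [folklore] -/
def skipArg {q : ℕ} (G : PVFun (q + 1)) : PVFun (q + 2) :=
  PVFun.comp G (Fin.snoc (fun j => PVFun.proj (Fin.castSucc (Fin.castSucc j))) (PVFun.proj (Fin.last (q + 1))))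

omit [Language.boundedArith.Structure K] [boundedArithToPV.IsExpansionOn K] hKB in
/-- **Fact.** `skipArg G (c̄, b, i) = G(c̄, i)` in `K`. [folklore] -/
theorem papp_skipArg (hK : K ⊨ trueUnivPV) {q : ℕ} (G : PVFun (q + 1)) (c : Fin q → K) (b i : K) :
    papp (skipArg G) (Fin.snoc (Fin.snoc c b) i) = papp G (Fin.snoc c i) := by
  have h := papp_termSym hK
    (Term.func G (Fin.snoc (fun j : Fin q => Term.var (Fin.castSucc (Fin.castSucc j)))
      (Term.var (Fin.last (q + 1))))) (Fin.snoc (Fin.snoc c b) i)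
  have e : termSym (Term.func G (Fin.snoc (fun j : Fin q => Term.var (Fin.castSucc (Fin.castSucc j)))
      (Term.var (Fin.last (q + 1))))) = skipArg G := by
    rw [termSym, skipArg]
    congr 1
    funext j
    cases j using Fin.lastCases with
    | last => simp [termSym]
    | cast j => simp [termSym]
  rw [e] at h
  rw [h, Term.realize]
  congr 1
  funext j
  cases j using Fin.lastCases with
  | last => simp
  | cast j => simp

/-- **Collection in a Herbrand-saturated model.** Let `ρ(x̄, i, w)` be open, `s(x̄)` and
`r(x̄, i)` terms of Buss's language.  If `∀ i ≤ |s(x̄)| ∃ w ≤ r(x̄, i) ρ(x̄, i, w)` holds in a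
Herbrand-saturated `K ⊨ trueUnivPV`, then there is `W ≤ (2 s + 1) # (2 b + 1)`, `b = r(x̄, |s|)`,
with `entry (W, i, 2b+1) ≤ r(x̄, i)` and `ρ(x̄, i, entry (W, i, 2b+1))` for all `i ≤ |s(x̄)|` —
sharply bounded replacement (`BB`) witnessed by a table (Buss 1986, §2.7, Thm. 14; Krajíček
1995, proof of Thm. 7.6.3). [cite: Krajicek1995, Theorem 7.6.3 (proof)] -/
theorem exists_table (hK : K ⊨ trueUnivPV) (hsat : IsHerbrandSaturated Language.pv K)
    {ρ : Language.pv.BoundedFormula Empty (n + 2)} (hρ : ρ.IsQF)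
    (s : Language.boundedArith.Term (Empty ⊕ Fin n))
    (r : Language.boundedArith.Term (Empty ⊕ Fin (n + 1))) (xs : Fin n → K)
    (h : ∀ i : K, i ≤ mLen (s.realize (Sum.elim default xs)) →
      ∃ w : K, w ≤ r.realize (Sum.elim default (Fin.snoc xs i)) ∧ ρ.Realize default (Fin.snoc (Fin.snoc xs i) w)) :
    ∃ W : K, W ≤ mSmash (2 * s.realize (Sum.elim default xs) + 1)
        (2 * r.realize (Sum.elim default (Fin.snoc xs (mLen (s.realize (Sum.elim default xs))))) + 1) ∧
      ∀ i : K, i ≤ mLen (s.realize (Sum.elim default xs)) →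
        papp PVFun.entry ![W, i, 2 * r.realize (Sum.elim default (Fin.snoc xs (mLen (s.realize (Sum.elim default xs))))) + 1]
            ≤ r.realize (Sum.elim default (Fin.snoc xs i)) ∧
        ρ.Realize default (Fin.snoc (Fin.snoc xs i)
          (papp PVFun.entry ![W, i, 2 * r.realize (Sum.elim default (Fin.snoc xs (mLen (s.realize (Sum.elim default xs))))) + 1])) := by
  set S : K := s.realize (Sum.elim default xs) with hS
  set b : K := r.realize (Sum.elim default (Fin.snoc xs (mLen S))) with hb
  -- the step formula `i ≤ |s| → w ≤ r(x̄, i) ∧ ρ(x̄, i, w)`, in context `(x̄, i, w)`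
  let upS : Language.pv.Term (Empty ⊕ Fin (n + 2)) :=
    ιt (s.relabel (Sum.map id (Fin.castSucc ∘ Fin.castSucc)))
  let upR : Language.pv.Term (Empty ⊕ Fin (n + 2)) := ιt (r.relabel (Sum.map id Fin.castSucc))
  let Θ : Language.pv.BoundedFormula Empty (n + 2) :=
    Term.le (cv (Fin.castSucc (Fin.last n))) (fn1 PVFun.len upS) ⟹
      (Term.le (cv (Fin.last (n + 1))) upR ⊓ ρ)
  have hΘ : Θ.IsQF := (IsAtomic.rel _ _).isQF.imp ((IsAtomic.rel _ _).isQF.inf hρ)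
  have hupS : ∀ i w : K, upS.realize (Sum.elim default (Fin.snoc (Fin.snoc xs i) w)) = S := by
    intro i w
    simp only [upS, realize_ιt, Term.realize_relabel, Sum.elim_comp_map, Function.comp_id, hS]
    congr 1
    funext a; rcases a with a | j
    · exact a.elim
    · simp
  have hupR : ∀ i w : K, upR.realize (Sum.elim default (Fin.snoc (Fin.snoc xs i) w)) =
      r.realize (Sum.elim default (Fin.snoc xs i)) := by
    intro i w
    simp only [upR, realize_ιt, Term.realize_relabel, Sum.elim_comp_map, Function.comp_id]
    congr 1
    funext a; rcases a with a | j
    · exact a.elim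
    · simp
  have hΘsem : ∀ i w : K, Θ.Realize default (Fin.snoc (Fin.snoc xs i) w) ↔
      (i ≤ mLen S → w ≤ r.realize (Sum.elim default (Fin.snoc xs i)) ∧
        ρ.Realize default (Fin.snoc (Fin.snoc xs i) w)) := by
    intro i w
    simp only [Θ, realize_imp, realize_inf, realize_pvle, Term.realize, Sum.elim_inr, Fin.snoc_castSucc,
      Fin.snoc_last, funMap_vec1, papp_len, hupS, hupR]
  -- Skolem symbol
  obtain ⟨q, c, G, hG⟩ := exists_skolem_sym_ctx₁ hK hsat hΘ xs fun i => by
    by_cases hi : i ≤ mLen S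
    · obtain ⟨w, hw, hρw⟩ := h i hi
      exact ⟨w, (hΘsem i w).2 fun _ => ⟨hw, hρw⟩⟩
    · exact ⟨0, (hΘsem i 0).2 fun hi' => absurd hi' hi⟩
  have hG' : ∀ i : K, i ≤ mLen S → papp G (Fin.snoc c i) ≤ r.realize (Sum.elim default (Fin.snoc xs i)) ∧
      ρ.Realize default (Fin.snoc (Fin.snoc xs i) (papp G (Fin.snoc c i))) :=
    fun i hi => (hΘsem i _).1 (hG i) hi
  -- the table of `G` truncated at `b`, over the parameters `(c̄, b)`
  let F : PVFun (q + 2) := skipArg G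
  let B : PVFun (q + 1) := PVFun.lastv
  have hB : papp B (Fin.snoc c b) = b := by
    have := papp_termSym hK (Term.var (Fin.last q) : Language.pv.Term (Fin (q + 1))) (Fin.snoc c b)
    simpa [termSym, B, PVFun.lastv] using this
  have hF : ∀ i : K, papp F (Fin.snoc (Fin.snoc c b) i) = papp G (Fin.snoc c i) :=
    fun i => papp_skipArg hK G c b i
  refine ⟨papp (PVFun.tbl F B) (Fin.snoc (Fin.snoc c b) S), ?_, fun i hi => ?_⟩
  · have h1 := tbl_le' hK F B (Fin.snoc c b) S
    rwa [hB] at h1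
  · have hmono : r.realize (Sum.elim default (Fin.snoc xs i)) ≤ b := by
      rw [hb]
      refine realize_mono hK r fun a => ?_
      rcases a with a | j
      · exact a.elim
      · cases j using Fin.lastCases with
        | last => simpa using hi
        | cast j => simp
    obtain ⟨hGr, hGρ⟩ := hG' i hi
    have hFi : papp F (Fin.snoc (Fin.snoc c b) i) ≤ papp B (Fin.snoc c b) := by
      rw [hF, hB]; exact le_trans hGr hmono
    have hdec := entry_tbl' hK F B (Fin.snoc c b) hi hFi
    rw [hB] at hdec
    rw [hdec, hF]
    exact ⟨hGr, hGρ⟩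

end Collect

end Literature.Analysis.FunctionSpaces
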